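import Summits.QuantumFields.YangMills.Theorems.F4SubCurvatureDoorShortRootRigidityPlanarNarrowTube
import Summits.QuantumFields.YangMills.Theorems.F4SubCurvatureDoorAngularContinuationCharts
import Literature.Analysis.Complex.HolomorphicParametricIntegral
import Mathlib
import HarnessLib

/-!
# LINE g21-C «aperture bootstrap» (crux ⟨stmt-QuantumFields-23035⟩ `ShortRootRigidity`) — R-S3d helpers H1–H3: the two frame tubes glue

Owner STUB-PLAN `Cruxes/ShortRootRigidity/Lines/aperture_bootstrap_stubplans.md` (planner ym-idea-3 g21, sha16 a045f2eb0c54f2ce), steps H1–H3 for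
the registered stub `stub_planarApertureStep : FlatDoubleEdge → PlanarApertureStep` (L, THE step).  For a measure `μ` on `ℝ × ℝ` carried by
`E ≥ 0`, Laplace-integrable, with APERTURE `τ` IN SUPPORT FORM (`μ{E < τ|p|} = 0`):

* H1 `differentiableOn_F0` / `norm_F0_le`: the frame-0 transform `F₀(ζ, β) = ∫ e^{−ζE} cos(βp) dμ` is holomorphic on the tube
  `T₀(τ) = {|Im β| < τ Re ζ}` with the majorant `∫ e^{−(Re ζ − |Im β|/τ)E} dμ` (support domination `|p| ≤ E/τ` a.e. instead of the exponential
  moments of `planarNarrowTube`; tree lemma `Literature.Analysis.Complex.differentiableOn_integral_of_dominated`);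
* H2 `differentiableOn_Fplus` / `Fplus_ofReal`: the frame-`+60°` function `F₊ = F₀ ∘ L₊`, `L₊ z = (z·u₊, z·u₊^⊥)`, holomorphic on
  `T₊(τ) = L₊⁻¹ T₀(τ)`, with real trace `k` (rotation by `−60°` is `−hexReflection ∘ timeReflection`, an `InPlanarClass` symmetry);
* H3 `F0_eq_Fplus`: `F₀ = F₊` on `T₀(τ) ∩ T₊(τ)` — the two-slice one-variable identity argument (real `β` first, then the `β`-slice at fixed `ζ`),
  with the tree's `eqOn_of_eq_on_real` on convex slices.

HONEST LABEL: helpers toward a registered stub of an OPEN line; `stub_planarApertureStep`, (C), ⟨23035⟩, R2d and the Yang–Mills mass gap remain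
OPEN; no summit is proved by a line.  Lead seat `ym-line-sfw-p2` g75 (cell ym-idea-1, free hands).
-/

set_option autoImplicit false

noncomputable section

open MeasureTheory Filter Topology Set Metric Complex
open scoped BigOperators

namespace Summit.QuantumFields.YangMills.Theorems.F4SubCurvatureDoorPlanarFrameGluing

open Literature.MathematicalPhysics.QuantumLattice (timeReflection timeReflection_apply)
open Summit.QuantumFields.YangMills.Theorems.F4SubCurvatureDoorSliceDensityRegistered (E2)
open Summit.QuantumFields.YangMills.Theorems.F4SubCurvatureDoorSliceInClassRegistered (hexReflection InPlanarClass)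
open Summit.QuantumFields.YangMills.Cruxes.ShortRootRigidity.AngularType (mk2)
open Summit.QuantumFields.YangMills.Cruxes.ShortRootRigidity.AngularType.AngularChartA (eqOn_of_eq_on_real)
open Summit.QuantumFields.YangMills.Theorems.F4SubCurvatureDoorPlanarLaplaceFourier (ae_energy_nonneg)
open Summit.QuantumFields.YangMills.Theorems.F4SubCurvatureDoorPlanarNarrowTube (norm_kernel_le)

/-! ## Vocabulary -/

/-- The frame-0 complex Laplace–Fourier transform `F₀(ζ, β) = ∫ e^{−ζE} cos(βp) dμ`. -/
def F0 (μ : Measure (ℝ × ℝ)) (q : ℂ × ℂ) : ℂ :=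
  ∫ z : ℝ × ℝ, Complex.exp (-(q.1 * (z.1 : ℂ))) * Complex.cos (q.2 * (z.2 : ℂ)) ∂μ

/-- The frame-0 tube of aperture `τ`: `{|Im β| < τ Re ζ}`. -/
def tube (τ : ℝ) : Set (ℂ × ℂ) := {q : ℂ × ℂ | |q.2.im| < τ * q.1.re}

/-- The frame-`+60°` coordinates `L₊ z = (z·u₊, z·u₊^⊥)`, `u₊ = (1/2, √3/2)`, `u₊^⊥ = (−√3/2, 1/2)` (ℂ-bilinear extension). -/
def Lplus (q : ℂ × ℂ) : ℂ × ℂ :=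
  ((1 / 2 : ℂ) * q.1 + ((Real.sqrt 3 / 2 : ℝ) : ℂ) * q.2, -(((Real.sqrt 3 / 2 : ℝ) : ℂ) * q.1) + (1 / 2 : ℂ) * q.2)

/-- The frame-`+60°` transform. -/
def Fplus (μ : Measure (ℝ × ℝ)) (q : ℂ × ℂ) : ℂ := F0 μ (Lplus q)

/-- The frame-`+60°` tube of aperture `τ`. -/
def tubePlus (τ : ℝ) : Set (ℂ × ℂ) := Lplus ⁻¹' tube τ

/-! ## Convexity / openness tools -/

/-- `{z | |φ z| < ψ z}` is convex for `ℝ`-linear `φ, ψ`. -/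
theorem convex_abs_lt {V : Type*} [AddCommGroup V] [Module ℝ V] (φ ψ : V →ₗ[ℝ] ℝ) :
    Convex ℝ {z : V | |φ z| < ψ z} := by
  intro x hx y hy a b ha hb hab
  simp only [mem_setOf_eq, map_add, map_smul, smul_eq_mul] at hx hy ⊢
  have h1 : |a * φ x + b * φ y| ≤ a * |φ x| + b * |φ y| := by
    calc |a * φ x + b * φ y| ≤ |a * φ x| + |b * φ y| := abs_add_le _ _
      _ = a * |φ x| + b * |φ y| := by rw [abs_mul, abs_mul, abs_of_nonneg ha, abs_of_nonneg hb]
  rcases ha.lt_or_eq with ha' | ha'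
  · nlinarith [mul_le_mul_of_nonneg_left hy.le hb]
  · subst ha'
    simp only [zero_add] at hab
    subst hab
    simp only [zero_mul, zero_add, one_mul] at h1 ⊢
    exact lt_of_le_of_lt h1 hy

/-- `Im ∘ snd` as an `ℝ`-linear map on `ℂ × ℂ`. -/
def imSnd : (ℂ × ℂ) →ₗ[ℝ] ℝ := Complex.imLm.comp (LinearMap.snd ℝ ℂ ℂ)
/-- `Re ∘ fst` as an `ℝ`-linear map on `ℂ × ℂ`. -/
def reFst : (ℂ × ℂ) →ₗ[ℝ] ℝ := Complex.reLm.comp (LinearMap.fst ℝ ℂ ℂ)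

/-- `L₊` as an `ℝ`-linear (indeed `ℂ`-linear) map. -/
def LplusLin : (ℂ × ℂ) →ₗ[ℝ] (ℂ × ℂ) where
  toFun := Lplus
  map_add' x y := by ext <;> simp [Lplus] <;> ring
  map_smul' c x := by ext <;> simp [Lplus] <;> ring

/-- The tubes are convex. -/
theorem convex_tube (τ : ℝ) : Convex ℝ (tube τ) :=
  convex_abs_lt imSnd (τ • reFst)

/-- The rotated tubes are convex. -/
theorem convex_tubePlus (τ : ℝ) : Convex ℝ (tubePlus τ) :=
  convex_abs_lt (imSnd.comp LplusLin) ((τ • reFst).comp LplusLin)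

/-- `L₊` is continuous. -/
theorem continuous_Lplus : Continuous Lplus := by unfold Lplus; fun_prop

/-- `L₊` is holomorphic. -/
theorem differentiable_Lplus : Differentiable ℂ Lplus := by unfold Lplus; fun_prop

/-- The tubes are open. -/
theorem isOpen_tube (τ : ℝ) : IsOpen (tube τ) :=
  isOpen_lt (continuous_abs.comp (Complex.continuous_im.comp continuous_snd)) (continuous_const.mul (Complex.continuous_re.comp continuous_fst))

/-- The rotated tubes are open. -/
theorem isOpen_tubePlus (τ : ℝ) : IsOpen (tubePlus τ) := (isOpen_tube τ).preimage continuous_Lplus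

/-! ## H1: the frame-0 tube from the support -/

section Frame0

variable {μ : Measure (ℝ × ℝ)} {τ : ℝ}

/-- Support domination: `0 ≤ E` and `τ|p| ≤ E` almost everywhere. -/
theorem ae_support (hμ0 : μ (Iio 0 ×ˢ univ) = 0) (hap : μ {z : ℝ × ℝ | z.1 < τ * |z.2|} = 0) :
    ∀ᵐ z ∂μ, 0 ≤ z.1 ∧ τ * |z.2| ≤ z.1 := by
  have h1 := ae_energy_nonneg hμ0
  have h2 : ∀ᵐ z ∂μ, z ∉ {z : ℝ × ℝ | z.1 < τ * |z.2|} := measure_eq_zero_iff_ae_notMem.1 hap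
  filter_upwards [h1, h2] with z hz1 hz2
  exact ⟨hz1, not_lt.1 hz2⟩

/-- The dominator `e^{−t₁E + β₁p} + e^{−t₁E − β₁p}` is integrable as soon as `t₁ − β₁/τ > 0` (support domination). -/
theorem integrable_dominator (hτ : 0 < τ) (hμ0 : μ (Iio 0 ×ˢ univ) = 0) (hap : μ {z : ℝ × ℝ | z.1 < τ * |z.2|} = 0)
    (hint : ∀ s : ℝ, 0 < s → Integrable (fun z : ℝ × ℝ => Real.exp (-(s * z.1))) μ) {t₁ β₁ : ℝ} (hβ₁ : 0 ≤ β₁)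
    (hgap : 0 < t₁ - β₁ / τ) :
    Integrable (fun z : ℝ × ℝ => Real.exp (-(t₁ * z.1) + β₁ * z.2) + Real.exp (-(t₁ * z.1) + -β₁ * z.2)) μ := by
  have hdom : ∀ s : ℝ, |s| = β₁ → Integrable (fun z : ℝ × ℝ => Real.exp (-(t₁ * z.1) + s * z.2)) μ := by
    intro s hs
    refine (hint _ hgap).mono' (by fun_prop) ?_
    filter_upwards [ae_support hμ0 hap] with z hz
    rw [Real.norm_eq_abs, abs_of_pos (Real.exp_pos _)]
    refine Real.exp_le_exp.2 ?_
    have h1 : s * z.2 ≤ β₁ * |z.2| := by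
      calc s * z.2 ≤ |s * z.2| := le_abs_self _
        _ = |s| * |z.2| := abs_mul _ _
        _ = β₁ * |z.2| := by rw [hs]
    have h2 : β₁ * |z.2| ≤ β₁ / τ * z.1 := by
      rw [div_mul_eq_mul_div, le_div_iff₀ hτ]
      nlinarith [hz.2]
    nlinarith
  exact (hdom β₁ (abs_of_nonneg hβ₁)).add (hdom (-β₁) (by rw [abs_neg, abs_of_nonneg hβ₁]))

/-- Inside the tube the time part is positive. -/
theorem re_pos_of_mem_tube (hτ : 0 < τ) {q : ℂ × ℂ} (hq : q ∈ tube τ) : 0 < q.1.re := by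
  have h : |q.2.im| < τ * q.1.re := hq
  by_contra hle
  have : τ * q.1.re ≤ 0 := mul_nonpos_of_nonneg_of_nonpos hτ.le (not_lt.1 hle)
  linarith [abs_nonneg q.2.im]

/-- **H1 (holomorphy).**  The frame-0 transform is holomorphic on the tube of aperture `τ`. -/
theorem differentiableOn_F0 (hτ : 0 < τ) (hμ0 : μ (Iio 0 ×ˢ univ) = 0) (hap : μ {z : ℝ × ℝ | z.1 < τ * |z.2|} = 0)
    (hint : ∀ s : ℝ, 0 < s → Integrable (fun z : ℝ × ℝ => Real.exp (-(s * z.1))) μ) :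
    DifferentiableOn ℂ (F0 μ) (tube τ) := by
  have hKc : ∀ q : ℂ × ℂ, Continuous fun z : ℝ × ℝ => Complex.exp (-(q.1 * (z.1 : ℂ))) * Complex.cos (q.2 * (z.2 : ℂ)) :=
    fun q => by fun_prop
  have hKd : ∀ z : ℝ × ℝ, Differentiable ℂ fun q : ℂ × ℂ => Complex.exp (-(q.1 * (z.1 : ℂ))) * Complex.cos (q.2 * (z.2 : ℂ)) :=
    fun z => by fun_prop
  refine Literature.Analysis.Complex.differentiableOn_integral_of_dominated (fun q _ => (hKc q).aestronglyMeasurable)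
    (Eventually.of_forall fun z => (hKd z).differentiableOn) ?_
  intro q₀ hq₀
  have hq₀' : |q₀.2.im| < τ * q₀.1.re := hq₀
  have ht₀ : 0 < q₀.1.re := re_pos_of_mem_tube hτ hq₀
  -- the margin
  set R : ℝ := (τ * q₀.1.re - |q₀.2.im|) / (2 * (1 + τ)) with hR
  have hRpos : 0 < R := by rw [hR]; exact div_pos (by linarith) (by positivity)
  have hR1 : R * (1 + τ) < τ * q₀.1.re - |q₀.2.im| := by
    rw [hR, div_mul_eq_mul_div, div_lt_iff₀ (by positivity)]
    nlinarith [abs_nonneg q₀.2.im]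
  set t₁ : ℝ := q₀.1.re - R with ht₁
  set β₁ : ℝ := |q₀.2.im| + R with hβ₁
  have hβ₁0 : 0 ≤ β₁ := by rw [hβ₁]; positivity
  have hgap : 0 < t₁ - β₁ / τ := by
    rw [ht₁, hβ₁, sub_pos, div_lt_iff₀ hτ]
    nlinarith
  refine ⟨R, hRpos, ?_, _, integrable_dominator hτ hμ0 hap hint hβ₁0 hgap, ?_⟩
  · -- the ball stays in the tube
    intro q hq
    rw [mem_ball, Prod.dist_eq, max_lt_iff] at hq
    have h1 : |q.1.re - q₀.1.re| < R := lt_of_le_of_lt (by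
      simpa using Complex.abs_re_le_norm (q.1 - q₀.1)) (by rw [← dist_eq_norm]; exact hq.1)
    have h2 : |q.2.im - q₀.2.im| < R := lt_of_le_of_lt (by
      simpa using Complex.abs_im_le_norm (q.2 - q₀.2)) (by rw [← dist_eq_norm]; exact hq.2)
    show |q.2.im| < τ * q.1.re
    rw [abs_lt] at h1
    have h3 := abs_add_le (q.2.im - q₀.2.im) q₀.2.im
    rw [sub_add_cancel] at h3
    nlinarith
  · -- domination
    filter_upwards [ae_energy_nonneg hμ0] with z hz q hq
    rw [mem_ball, Prod.dist_eq, max_lt_iff] at hq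
    have h1 : |q.1.re - q₀.1.re| < R := lt_of_le_of_lt (by
      simpa using Complex.abs_re_le_norm (q.1 - q₀.1)) (by rw [← dist_eq_norm]; exact hq.1)
    have h2 : |q.2.im - q₀.2.im| < R := lt_of_le_of_lt (by
      simpa using Complex.abs_im_le_norm (q.2 - q₀.2)) (by rw [← dist_eq_norm]; exact hq.2)
    rw [abs_lt] at h1
    refine norm_kernel_le hz ?_ ?_
    · rw [ht₁]; linarith
    · rw [hβ₁]
      have h3 := abs_add_le (q.2.im - q₀.2.im) q₀.2.im
      rw [sub_add_cancel] at h3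
      linarith [h2.le]

/-- **H1 (bound).**  `‖F₀(ζ, β)‖ ≤ ∫ e^{−(Re ζ − |Im β|/τ)E} dμ` on the tube. -/
theorem norm_F0_le (hτ : 0 < τ) (hμ0 : μ (Iio 0 ×ˢ univ) = 0) (hap : μ {z : ℝ × ℝ | z.1 < τ * |z.2|} = 0)
    (hint : ∀ s : ℝ, 0 < s → Integrable (fun z : ℝ × ℝ => Real.exp (-(s * z.1))) μ) {q : ℂ × ℂ} (hq : q ∈ tube τ) :
    ‖F0 μ q‖ ≤ ∫ z : ℝ × ℝ, Real.exp (-((q.1.re - |q.2.im| / τ) * z.1)) ∂μ := by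
  have hq' : |q.2.im| < τ * q.1.re := hq
  have hgap : 0 < q.1.re - |q.2.im| / τ := by
    rw [sub_pos, div_lt_iff₀ hτ]; linarith
  have hbound : ∀ᵐ z ∂μ, ‖Complex.exp (-(q.1 * (z.1 : ℂ))) * Complex.cos (q.2 * (z.2 : ℂ))‖
      ≤ Real.exp (-((q.1.re - |q.2.im| / τ) * z.1)) := by
    filter_upwards [ae_support hμ0 hap] with z hz
    rw [norm_mul, Complex.norm_exp]
    have hre : (-(q.1 * (z.1 : ℂ))).re = -(q.1.re * z.1) := by simp [Complex.mul_re]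
    have him : (q.2 * (z.2 : ℂ)).im = q.2.im * z.2 := by simp [Complex.mul_im]
    have hcos := Summit.QuantumFields.YangMills.Theorems.F4SubCurvatureDoorPlanarNarrowTube.norm_cos_le (q.2 * (z.2 : ℂ))
    rw [him] at hcos
    rw [hre]
    -- `cosh(Im β · p) ≤ e^{|Im β||p|} ≤ e^{(|Im β|/τ) E}`
    have hp : |q.2.im * z.2| ≤ |q.2.im| / τ * z.1 := by
      rw [abs_mul, div_mul_eq_mul_div, le_div_iff₀ hτ]
      nlinarith [abs_nonneg q.2.im, hz.2]
    have h1 : Real.exp (q.2.im * z.2) ≤ Real.exp (|q.2.im| / τ * z.1) := Real.exp_le_exp.2 ((le_abs_self _).trans hp)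
    have h2 : Real.exp (-(q.2.im * z.2)) ≤ Real.exp (|q.2.im| / τ * z.1) := Real.exp_le_exp.2 ((neg_le_abs _).trans hp)
    calc Real.exp (-(q.1.re * z.1)) * ‖Complex.cos (q.2 * (z.2 : ℂ))‖
        ≤ Real.exp (-(q.1.re * z.1)) * ((Real.exp (q.2.im * z.2) + Real.exp (-(q.2.im * z.2))) / 2) :=
          mul_le_mul_of_nonneg_left hcos (Real.exp_pos _).le
      _ ≤ Real.exp (-(q.1.re * z.1)) * Real.exp (|q.2.im| / τ * z.1) :=
          mul_le_mul_of_nonneg_left (by linarith) (Real.exp_pos _).le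
      _ = Real.exp (-((q.1.re - |q.2.im| / τ) * z.1)) := by rw [← Real.exp_add]; ring_nf
  exact (norm_integral_le_of_norm_le (hint _ hgap) hbound)

/-- **H1 (real points).**  `F₀(t, b) = k(t, b)` for `t > 0`, `b ∈ ℝ`, when `μ` represents `k`. -/
theorem F0_ofReal {k : E2 → ℝ} (hrep : ∀ t : ℝ, 0 < t → ∀ x : ℝ, k (mk2 t x) = ∫ z, Real.exp (-(z.1 * t)) * Real.cos (z.2 * x) ∂μ)
    {t : ℝ} (ht : 0 < t) (b : ℝ) : F0 μ ((t : ℂ), (b : ℂ)) = ((k (mk2 t b) : ℝ) : ℂ) := by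
  rw [hrep t ht b, ← integral_complex_ofReal, F0]
  refine integral_congr_ae (Eventually.of_forall fun z => ?_)
  dsimp only
  rw [show -((t : ℂ) * (z.1 : ℂ)) = ((-(z.1 * t) : ℝ) : ℂ) by push_cast; ring,
    show (b : ℂ) * (z.2 : ℂ) = ((z.2 * b : ℝ) : ℂ) by push_cast; ring,
    ← Complex.ofReal_exp, ← Complex.ofReal_cos]
  push_cast; ring

end Frame0

/-! ## H2: the frame-`+60°` function -/

section FramePlus

variable {μ : Measure (ℝ × ℝ)} {τ : ℝ} {k : E2 → ℝ}

/-- Coordinates of `L₊`: time part. -/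
theorem Lplus_fst_re (ζ β : ℂ) : (Lplus (ζ, β)).1.re = ζ.re / 2 + Real.sqrt 3 / 2 * β.re := by
  simp [Lplus, Complex.mul_re]; ring

/-- Coordinates of `L₊`: imaginary part of the space part. -/
theorem Lplus_snd_im (ζ β : ℂ) : (Lplus (ζ, β)).2.im = -(Real.sqrt 3 / 2 * ζ.im) + β.im / 2 := by
  simp [Lplus, Complex.mul_im]; ring

/-- `L₊` on real points. -/
theorem Lplus_ofReal (a b : ℝ) :
    Lplus ((a : ℂ), (b : ℂ)) = (((a / 2 + Real.sqrt 3 / 2 * b : ℝ) : ℂ), ((-(Real.sqrt 3 / 2 * a) + b / 2 : ℝ) : ℂ)) := by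
  ext <;> simp [Lplus] <;> ring

/-- Membership in the rotated tube, in coordinates. -/
theorem mem_tubePlus_iff (ζ β : ℂ) :
    (ζ, β) ∈ tubePlus τ ↔ |-(Real.sqrt 3 / 2 * ζ.im) + β.im / 2| < τ * (ζ.re / 2 + Real.sqrt 3 / 2 * β.re) := by
  show |(Lplus (ζ, β)).2.im| < τ * (Lplus (ζ, β)).1.re ↔ _
  rw [Lplus_fst_re, Lplus_snd_im]

/-- **H2 (holomorphy).**  `F₊` is holomorphic on `T₊(τ)`. -/
theorem differentiableOn_Fplus (hτ : 0 < τ) (hμ0 : μ (Iio 0 ×ˢ univ) = 0) (hap : μ {z : ℝ × ℝ | z.1 < τ * |z.2|} = 0)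
    (hint : ∀ s : ℝ, 0 < s → Integrable (fun z : ℝ × ℝ => Real.exp (-(s * z.1))) μ) :
    DifferentiableOn ℂ (Fplus μ) (tubePlus τ) :=
  (differentiableOn_F0 hτ hμ0 hap hint).comp differentiable_Lplus.differentiableOn fun _ hq => hq

/-- Rotation by `−60°` in coordinates is `−hexReflection ∘ timeReflection`. -/
theorem mk2_rot (a b : ℝ) :
    mk2 (a / 2 + Real.sqrt 3 / 2 * b) (-(Real.sqrt 3 / 2 * a) + b / 2) = -(hexReflection (timeReflection 2 (mk2 a b))) := by
  ext i
  fin_cases i <;> simp [mk2, hexReflection, timeReflection_apply] <;> ring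

/-- The planar class is invariant under the rotation by `−60°`. -/
theorem InPlanarClass.rot (hk : InPlanarClass k) (a b : ℝ) :
    k (mk2 (a / 2 + Real.sqrt 3 / 2 * b) (-(Real.sqrt 3 / 2 * a) + b / 2)) = k (mk2 a b) := by
  obtain ⟨-, -, hT, hH, hneg, -, -⟩ := hk
  rw [mk2_rot, hneg, hH, hT]

/-- **H2 (real points).**  `F₊(a, b) = k(a, b)` whenever `(a, b)·u₊ > 0`. -/
theorem Fplus_ofReal (hk : InPlanarClass k)
    (hrep : ∀ t : ℝ, 0 < t → ∀ x : ℝ, k (mk2 t x) = ∫ z, Real.exp (-(z.1 * t)) * Real.cos (z.2 * x) ∂μ)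
    {a b : ℝ} (hab : 0 < a / 2 + Real.sqrt 3 / 2 * b) : Fplus μ ((a : ℂ), (b : ℂ)) = ((k (mk2 a b) : ℝ) : ℂ) := by
  rw [Fplus, Lplus_ofReal, F0_ofReal hrep hab, InPlanarClass.rot hk]

end FramePlus

/-! ## H3: the two frames glue on `T₀(τ) ∩ T₊(τ)` -/

section Glue

variable {μ : Measure (ℝ × ℝ)} {τ : ℝ} {k : E2 → ℝ}

/-- The `ζ`-slice at a fixed `β` as an affine map. -/
def sliceFst (β : ℂ) : ℂ →ᵃ[ℝ] ℂ × ℂ :=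
  ⟨fun ζ => (ζ, β), LinearMap.inl ℝ ℂ ℂ, fun p v => by ext <;> simp⟩

/-- The `β`-slice at a fixed `ζ` as an affine map. -/
def sliceSnd (ζ : ℂ) : ℂ →ᵃ[ℝ] ℂ × ℂ :=
  ⟨fun β => (ζ, β), LinearMap.inr ℝ ℂ ℂ, fun p v => by ext <;> simp⟩

/-- **H3.**  `F₀ = F₊` on `T₀(τ) ∩ T₊(τ)` (two-slice identity argument). -/
theorem F0_eq_Fplus (hτ : 0 < τ) (hμ0 : μ (Iio 0 ×ˢ univ) = 0) (hap : μ {z : ℝ × ℝ | z.1 < τ * |z.2|} = 0)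
    (hint : ∀ s : ℝ, 0 < s → Integrable (fun z : ℝ × ℝ => Real.exp (-(s * z.1))) μ) (hk : InPlanarClass k)
    (hrep : ∀ t : ℝ, 0 < t → ∀ x : ℝ, k (mk2 t x) = ∫ z, Real.exp (-(z.1 * t)) * Real.cos (z.2 * x) ∂μ) :
    EqOn (F0 μ) (Fplus μ) (tube τ ∩ tubePlus τ) := by
  have hF0 := differentiableOn_F0 hτ hμ0 hap hint
  have hFp := differentiableOn_Fplus hτ hμ0 hap hint
  have hs3 : 0 < Real.sqrt 3 := by positivity
  -- Step (a): agreement on every `ζ`-slice at a REAL `β = b`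
  have stepA : ∀ (b : ℝ) (ζ : ℂ), (ζ, (b : ℂ)) ∈ tube τ ∩ tubePlus τ → F0 μ (ζ, b) = Fplus μ (ζ, b) := by
    intro b ζ hζ
    set S : Set ℂ := (sliceFst (b : ℂ)) ⁻¹' (tube τ ∩ tubePlus τ) with hS
    have hSo : IsOpen S :=
      ((isOpen_tube τ).inter (isOpen_tubePlus τ)).preimage (by fun_prop : Continuous fun ζ : ℂ => (ζ, (b : ℂ)))
    have hSc : Convex ℝ S := ((convex_tube τ).inter (convex_tubePlus τ)).affine_preimage (sliceFst (b : ℂ))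
    -- a real point of the slice
    set s₀ : ℝ := Real.sqrt 3 * |b| + 1 with hs₀
    have hs₀S : ((s₀ : ℂ)) ∈ S := by
      show ((s₀ : ℂ), (b : ℂ)) ∈ tube τ ∩ tubePlus τ
      constructor
      · show |(b : ℂ).im| < τ * (s₀ : ℂ).re
        simp only [Complex.ofReal_im, abs_zero, Complex.ofReal_re]
        positivity
      · rw [mem_tubePlus_iff]
        simp only [Complex.ofReal_im, Complex.ofReal_re, mul_zero, neg_zero, zero_div, add_zero, abs_zero]
        have : 0 < s₀ / 2 + Real.sqrt 3 / 2 * b := by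
          rw [hs₀]; nlinarith [le_abs_self b, neg_abs_le b, abs_nonneg b]
        positivity
    refine eqOn_of_eq_on_real hSo hSc.isPreconnected (f := fun ζ => F0 μ (ζ, b)) (g := fun ζ => Fplus μ (ζ, b))
      (hF0.comp (by fun_prop : Differentiable ℂ fun ζ : ℂ => (ζ, (b : ℂ))).differentiableOn fun ζ hζ => hζ.1)
      (hFp.comp (by fun_prop : Differentiable ℂ fun ζ : ℂ => (ζ, (b : ℂ))).differentiableOn fun ζ hζ => hζ.2)
      hs₀S (fun t ht => ?_) hζ
    -- real points: both sides are `k(t, b)`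
    have ht' : ((t : ℂ), (b : ℂ)) ∈ tube τ ∩ tubePlus τ := ht
    have ht0 : 0 < t := by
      have := re_pos_of_mem_tube hτ ht'.1
      simpa using this
    have htb : 0 < t / 2 + Real.sqrt 3 / 2 * b := by
      have := re_pos_of_mem_tube hτ ht'.2
      rwa [Lplus_fst_re, Complex.ofReal_re, Complex.ofReal_re] at this
    show F0 μ ((t : ℂ), (b : ℂ)) = Fplus μ ((t : ℂ), (b : ℂ))
    rw [F0_ofReal hrep ht0, Fplus_ofReal hk hrep htb]
  -- Step (b): the `β`-slice at a fixed `ζ₀`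
  intro q hq
  obtain ⟨ζ₀, β₀⟩ := q
  set S' : Set ℂ := (sliceSnd ζ₀) ⁻¹' (tube τ ∩ tubePlus τ) with hS'
  have hS'o : IsOpen S' :=
    ((isOpen_tube τ).inter (isOpen_tubePlus τ)).preimage (by fun_prop : Continuous fun β : ℂ => (ζ₀, β))
  have hS'c : Convex ℝ S' := ((convex_tube τ).inter (convex_tubePlus τ)).affine_preimage (sliceSnd ζ₀)
  have hre : 0 < ζ₀.re := re_pos_of_mem_tube hτ hq.1
  -- a real point of the slice
  set b₀ : ℝ := 2 * (|ζ₀.im| + 1) / τ with hb₀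
  have hb₀pos : 0 < b₀ := by rw [hb₀]; positivity
  have hb₀S : ((b₀ : ℂ)) ∈ S' := by
    show (ζ₀, (b₀ : ℂ)) ∈ tube τ ∩ tubePlus τ
    constructor
    · show |(b₀ : ℂ).im| < τ * ζ₀.re
      simp only [Complex.ofReal_im, abs_zero]
      positivity
    · rw [mem_tubePlus_iff]
      simp only [Complex.ofReal_im, Complex.ofReal_re, zero_div, add_zero, abs_neg]
      rw [abs_mul, abs_of_pos (by positivity : (0 : ℝ) < Real.sqrt 3 / 2)]
      have hτb : τ * b₀ = 2 * (|ζ₀.im| + 1) := by rw [hb₀]; field_simp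
      have hs1 : 1 < Real.sqrt 3 := by
        rw [show (1 : ℝ) = Real.sqrt 1 by simp]
        exact Real.sqrt_lt_sqrt (by norm_num) (by norm_num)
      nlinarith [abs_nonneg ζ₀.im, mul_pos hτ hre]
  exact eqOn_of_eq_on_real hS'o hS'c.isPreconnected (f := fun β => F0 μ (ζ₀, β)) (g := fun β => Fplus μ (ζ₀, β))
    (hF0.comp (by fun_prop : Differentiable ℂ fun β : ℂ => (ζ₀, β)).differentiableOn fun β hβ => hβ.1)
    (hFp.comp (by fun_prop : Differentiable ℂ fun β : ℂ => (ζ₀, β)).differentiableOn fun β hβ => hβ.2)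
    hb₀S (fun t ht => stepA t ζ₀ ht) hq

end Glue

end Summit.QuantumFields.YangMills.Theorems.F4SubCurvatureDoorPlanarFrameGluing

end
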